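import Summits.QuantumFields.YangMills.Theorems.ColdStartUniversalityLatticeLangevinWilsonSemigroupLogSobolev
import Summits.QuantumFields.YangMills.Theorems.ColdStartUniversalityLatticeLangevinWilsonGeneratorPoincareOfDecay
import Literature.Probability.MarkovChains.LogSobolevConstant
import HarnessLib

/-!
# Route `ColdStartUniversality` (fixed-cut-off package): LOG-SOBOLEV(ρ) ⇒ POINCARÉ(2ρ) for the SZZ dynamics at every `(L, β')`,
# semigroup form and generator form (Bakry–Gentil–Ledoux Prop. 5.1.3, «apply LS to `1 + εg`»)

Helper file (seat `ym-line-csu-p1`, g21; `--supports stmt-QuantumFields-27363`).  SU(2) SZZ dynamics at `(L, β')`, `μ = μ_{β'}`, ANY realising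
kernel family `κ`, scale-`h` forms `h𝓔_h(G) = ∫G² dμ − ∫Gκ_hG dμ`, `Ent_μ(w) = ∫ w log w − (∫w) log ∫w`:
* `dirichletScale_const_add_smul` — `h𝓔_h(c + εb) = ε² h𝓔_h(b)`; `one_add_mul_log_le`; `entropy_sq_one_add_smul_ge` — for centred bounded
  `g` (`|g| ≤ M`, `εM ≤ 1/2`): `Ent_μ((1+εg)²) ≥ 2ε²∫g² − ε³(5M∫g² + (∫g²)²)` (`Literature…mul_log_ge_taylor3`);
* ★★ `semigroupPoincare_of_semigroupLogSobolev` — semigroup-form LSI(ρ) on `C(X)` ⇒ semigroup-form Poincaré(2ρ) on `C(X)`;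
* ★★ `generatorPoincare_of_generatorLogSobolev` — generator-form LSI(ρ) on `C³` cylinders ⇒ generator-form Poincaré(2ρ) on `C³`
  cylinders (via `semigroupLogSobolev_of_generatorLogSobolev` g21, decay `integral_sq_transition_sub_le_exp_of_semigroupPoincare` g17 and
  `generatorPoincare_of_integral_sq_transition_sub_le_exp` g18): the K-uniform hypothesis (ULS) of LINE 4's entropy route implies
  g18's (G) with `c ↦ 2c`.
THEOREMS ONLY, no definition, no sorry.  HONEST FRAMING: RECORD-rung R3 plumbing at FIXED cut-off; neither inequality is proved here;
nothing K-uniform is proved; no crux, rung or summit statement is proved; the Yang–Mills mass gap is NOT proved.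
-/

set_option autoImplicit false

noncomputable section

namespace Summit.QuantumFields.YangMills.Theorems.ColdStartUniversality

open MeasureTheory ProbabilityTheory Filter Set Topology
open scoped BigOperators NNReal ENNReal
open Literature.Probability.Process Literature.MathematicalPhysics.QuantumFieldTheory
open Literature.MathematicalPhysics.QuantumLattice (fundamentalRep fundamentalLatticeRep continuous_fundamentalRep)

variable {L : ℕ} [NeZero L]

/-! ## §1. Constants carry no energy -/

/-- **`h𝓔_h(c + ε b) = ε² h𝓔_h(b)`** for continuous `b`, constants `c, ε` and any realising kernel family: the scale-`h` Dirichlet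
form is quadratic, kills constants (`κ_h 1 = 1`) and `∫ κ_h b dμ = ∫ b dμ` (invariance, SZZ Lemma 3.3). [cite: ShenZhuZhu2022, §3 Lemma 3.3 (p. 13)] -/
theorem dirichletScale_const_add_smul (L : ℕ) [NeZero L] (β' : ℝ)
    (κ : ℝ≥0 → Kernel (GaugeConfig 3 L (Matrix.specialUnitaryGroup (Fin 2) ℂ))
      (GaugeConfig 3 L (Matrix.specialUnitaryGroup (Fin 2) ℂ))) [∀ t, IsMarkovKernel (κ t)]
    (hreal : ∀ (t : ℝ≥0) (x : GaugeConfig 3 L (Matrix.specialUnitaryGroup (Fin 2) ℂ))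
        (Ω : Type) [MeasurableSpace Ω] (P : Measure Ω) [IsProbabilityMeasure P]
        (W : ℝ≥0 → Ω → (Edge 3 L × NoiseIdx 2 → ℝ)) (hW : IsFlatBrownian W P)
        (U : ℝ≥0 → Ω → GaugeConfig 3 L (Matrix.specialUnitaryGroup (Fin 2) ℂ)),
        (∀ ω, U 0 ω = x) →
        (latticeLangevinDynamics (fundamentalLatticeRep 2) β').IsSolution (fundamentalRep (Fin 2))
          hW.natFiltration P W U →
        κ t x = P.map (U t))
    (h : ℝ≥0) {b : GaugeConfig 3 L (Matrix.specialUnitaryGroup (Fin 2) ℂ) → ℝ} (hb : Continuous b) (c ε : ℝ) :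
    (∫ x, (c + ε * b x) * (c + ε * b x) ∂(wilsonMeasure (d := 3) (L := L) (fundamentalRep (Fin 2)) β')) -
        ∫ x, (c + ε * b x) * (∫ y, (c + ε * b y) ∂(κ h x)) ∂(wilsonMeasure (d := 3) (L := L) (fundamentalRep (Fin 2)) β') =
      ε ^ 2 * ((∫ x, b x * b x ∂(wilsonMeasure (d := 3) (L := L) (fundamentalRep (Fin 2)) β')) -
        ∫ x, b x * (∫ y, b y ∂(κ h x)) ∂(wilsonMeasure (d := 3) (L := L) (fundamentalRep (Fin 2)) β')) := by
  classical
  haveI := secondCountableTopology_su2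
  haveI := borelSpace_config L
  set μ : Measure (GaugeConfig 3 L (Matrix.specialUnitaryGroup (Fin 2) ℂ)) :=
    wilsonMeasure (d := 3) (L := L) (fundamentalRep (Fin 2)) β' with hμ
  haveI : IsProbabilityMeasure μ :=
    isProbabilityMeasure_wilsonMeasure (d := 3) (L := L) (fundamentalRep (Fin 2)) (continuous_fundamentalRep (Fin 2)) β'
  obtain ⟨M, -, hM⟩ := exists_abs_le_of_continuous hb
  have hKb : Continuous fun x => ∫ y, b y ∂(κ h x) := continuous_integral_transitionKernel L β' κ hreal h hb
  have hK : ∀ x, ∫ y, (c + ε * b y) ∂(κ h x) = c + ε * ∫ y, b y ∂(κ h x) := by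
    intro x
    rw [integral_add (integrable_const c) ((integrable_of_continuous_of_compactSpace hb _).const_mul ε), integral_const,
      probReal_univ, one_smul, integral_const_mul]
  simp_rw [hK]
  have hinv : ∫ x, (∫ y, b y ∂(κ h x)) ∂μ = ∫ x, b x ∂μ :=
    integral_transitionKernel_integral_eq_wilson (L := L) β' κ hreal h hb.measurable ⟨M, hM⟩
  have ib : Integrable b μ := integrable_of_continuous_of_compactSpace hb _
  have iKb : Integrable (fun x => ∫ y, b y ∂(κ h x)) μ := integrable_of_continuous_of_compactSpace hKb _
  have ibb : Integrable (fun x => b x * b x) μ := integrable_of_continuous_of_compactSpace (hb.mul hb) _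
  have ibK : Integrable (fun x => b x * ∫ y, b y ∂(κ h x)) μ := integrable_of_continuous_of_compactSpace (hb.mul hKb) _
  have e1 : ∫ x, (c + ε * b x) * (c + ε * b x) ∂μ = c ^ 2 + 2 * c * ε * (∫ x, b x ∂μ) + ε ^ 2 * ∫ x, b x * b x ∂μ := by
    have ee : ∀ x, (c + ε * b x) * (c + ε * b x) = c ^ 2 + (2 * c * ε) * b x + ε ^ 2 * (b x * b x) := fun x => by ring
    simp_rw [ee]
    have i1 : Integrable (fun x => c ^ 2 + (2 * c * ε) * b x) μ := (integrable_const _).add (ib.const_mul _)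
    have i2 : Integrable (fun x => ε ^ 2 * (b x * b x)) μ := ibb.const_mul _
    have i3 : Integrable (fun x => (2 * c * ε) * b x) μ := ib.const_mul _
    rw [integral_add i1 i2, integral_add (integrable_const _) i3, integral_const, probReal_univ, one_smul, integral_const_mul,
      integral_const_mul]
  have e2 : ∫ x, (c + ε * b x) * (c + ε * ∫ y, b y ∂(κ h x)) ∂μ =
      c ^ 2 + c * ε * (∫ x, (∫ y, b y ∂(κ h x)) ∂μ) + c * ε * (∫ x, b x ∂μ) + ε ^ 2 * ∫ x, b x * ∫ y, b y ∂(κ h x) ∂μ := by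
    have ee : ∀ x, (c + ε * b x) * (c + ε * ∫ y, b y ∂(κ h x)) =
        c ^ 2 + (c * ε) * (∫ y, b y ∂(κ h x)) + (c * ε) * b x + ε ^ 2 * (b x * ∫ y, b y ∂(κ h x)) := fun x => by ring
    simp_rw [ee]
    have i1 : Integrable (fun x => (c * ε) * ∫ y, b y ∂(κ h x)) μ := iKb.const_mul _
    have i2 : Integrable (fun x => (c * ε) * b x) μ := ib.const_mul _
    have i3 : Integrable (fun x => ε ^ 2 * (b x * ∫ y, b y ∂(κ h x))) μ := ibK.const_mul _
    have i4 : Integrable (fun x => c ^ 2 + (c * ε) * ∫ y, b y ∂(κ h x)) μ := (integrable_const _).add i1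
    have i5 : Integrable (fun x => c ^ 2 + (c * ε) * (∫ y, b y ∂(κ h x)) + (c * ε) * b x) μ := i4.add i2
    rw [integral_add i5 i3, integral_add i4 i2, integral_add (integrable_const _) i1, integral_const, probReal_univ, one_smul,
      integral_const_mul, integral_const_mul, integral_const_mul]
  rw [e1, e2, hinv]
  ring

/-! ## §2. The entropy of `(1 + εg)²` to second order -/

/-- `(1 + u) log(1 + u) ≤ u + u²` for `u ≥ 0` (`log(1+u) ≤ u`). [folklore] -/
theorem one_add_mul_log_le {u : ℝ} (hu : 0 ≤ u) : (1 + u) * Real.log (1 + u) ≤ u + u ^ 2 := by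
  have h1 : Real.log (1 + u) ≤ u := by
    have := Real.log_le_sub_one_of_pos (show 0 < 1 + u by linarith); linarith
  nlinarith

/-- **Second-order expansion of `Ent_μ((1+εg)²)`** for a centred bounded `g` on a probability space: if `∫ g dμ = 0`, `|g| ≤ M`,
`0 ≤ ε`, `ε ≤ 1` and `εM ≤ 1/2`, then `Ent_μ((1+εg)²) ≥ 2ε²V − ε³(5MV + V²)`, `V = ∫ g² dμ`
(`(1+w)log(1+w) ≥ w + w²/2 − w³/6`, `Literature.Probability.MarkovChains.mul_log_ge_taylor3`, with `w = 2εg + ε²g²`).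
[cite: BakryGentilLedoux2014, Prop. 5.1.3 (proof)] -/
theorem entropy_sq_one_add_smul_ge {X : Type*} [MeasurableSpace X] (μ : Measure X) [IsProbabilityMeasure μ]
    {g : X → ℝ} (hgm : Measurable g) {M ε : ℝ} (hgM : ∀ x, |g x| ≤ M) (hg0 : ∫ x, g x ∂μ = 0) (hε : 0 ≤ ε) (hε1 : ε ≤ 1)
    (hεM : ε * M ≤ 1 / 2) :
    2 * ε ^ 2 * (∫ x, g x ^ 2 ∂μ) - ε ^ 3 * (5 * M * (∫ x, g x ^ 2 ∂μ) + (∫ x, g x ^ 2 ∂μ) ^ 2) ≤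
      (∫ x, (1 + ε * g x) ^ 2 * Real.log ((1 + ε * g x) ^ 2) ∂μ) -
        (∫ x, (1 + ε * g x) ^ 2 ∂μ) * Real.log (∫ x, (1 + ε * g x) ^ 2 ∂μ) := by
  rcases isEmpty_or_nonempty X with hX | hX
  · exact absurd (measure_univ (μ := μ)) (by rw [Measure.eq_zero_of_isEmpty μ]; simp)
  have hM0 : 0 ≤ M := (abs_nonneg _).trans (hgM (Classical.arbitrary X))
  set V : ℝ := ∫ x, g x ^ 2 ∂μ with hV
  have hV0 : 0 ≤ V := integral_nonneg fun x => sq_nonneg _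
  have hbint : ∀ {φ : X → ℝ}, Measurable φ → ∀ C : ℝ, (∀ x, |φ x| ≤ C) → Integrable φ μ := fun hφ C hC =>
    Integrable.of_bound hφ.aestronglyMeasurable C (ae_of_all _ fun x => by rw [Real.norm_eq_abs]; exact hC x)
  have ig : Integrable g μ := hbint hgm M hgM
  have hg2b : ∀ x, |g x ^ 2| ≤ M ^ 2 := fun x => by rw [abs_pow]; exact pow_le_pow_left₀ (abs_nonneg _) (hgM x) 2
  have ig2 : Integrable (fun x => g x ^ 2) μ := hbint (hgm.pow_const 2) _ hg2b
  have ht : ∀ x, |ε * g x| ≤ 1 / 2 := fun x => by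
    rw [abs_mul, abs_of_nonneg hε]; exact (mul_le_mul_of_nonneg_left (hgM x) hε).trans hεM
  have hpos : ∀ x, 0 < (1 + ε * g x) ^ 2 := fun x => by
    have h1 : 0 < 1 + ε * g x := by linarith [neg_le_of_abs_le (ht x)]
    exact pow_pos h1 2
  -- the pointwise lower bound `h log h ≥ w + (2ε² − 5ε³M) g²`, `h = (1+εg)²`, `w = h − 1`
  have hpt : ∀ x, (2 * ε * g x + ε ^ 2 * g x ^ 2) + (2 * ε ^ 2 - 5 * ε ^ 3 * M) * g x ^ 2 ≤
      (1 + ε * g x) ^ 2 * Real.log ((1 + ε * g x) ^ 2) := by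
    intro x
    set t : ℝ := ε * g x with htdef
    have ht1 : |t| ≤ 1 / 2 := ht x
    have htM : |t| ≤ ε * M := by rw [htdef, abs_mul, abs_of_nonneg hε]; exact mul_le_mul_of_nonneg_left (hgM x) hε
    set w : ℝ := (1 + t) ^ 2 - 1 with hwdef
    have hw : w = 2 * t + t ^ 2 := by rw [hwdef]; ring
    have h1 := Literature.Probability.MarkovChains.mul_log_ge_taylor3 (hpos x)
    have e1 : (1 + ε * g x) ^ 2 - 1 = w := by rw [hwdef, htdef]
    rw [e1] at h1
    have hwabs : |w| ≤ 5 / 2 * |t| := by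
      rw [hw, show 2 * t + t ^ 2 = t * (2 + t) by ring, abs_mul, mul_comm]
      refine mul_le_mul_of_nonneg_right ?_ (abs_nonneg _)
      have := abs_le.1 ht1
      rw [abs_le]; constructor <;> linarith
    have ht2 : t ^ 2 = ε ^ 2 * g x ^ 2 := by rw [htdef]; ring
    have hw2 : 4 * t ^ 2 - 4 * (ε * M) * t ^ 2 ≤ w ^ 2 := by
      have h3 : -(ε * M) * t ^ 2 ≤ t ^ 3 := by
        have : t ^ 3 = t * t ^ 2 := by ring
        rw [this]
        exact mul_le_mul_of_nonneg_right (by linarith [neg_abs_le t]) (sq_nonneg t)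
      nlinarith [sq_nonneg (t ^ 2)]
    have hw3 : w ^ 3 ≤ 125 / 8 * (ε * M) * t ^ 2 := by
      have h4 : w ^ 3 ≤ |w| ^ 3 := by
        calc w ^ 3 ≤ |w ^ 3| := le_abs_self _
          _ = |w| ^ 3 := abs_pow w 3
      have h5 : |w| ^ 3 ≤ (5 / 2 * |t|) ^ 3 := pow_le_pow_left₀ (abs_nonneg _) hwabs 3
      have h6 : |t| ^ 3 ≤ (ε * M) * t ^ 2 := by
        rw [show |t| ^ 3 = |t| * |t| ^ 2 by ring, sq_abs]
        exact mul_le_mul_of_nonneg_right htM (sq_nonneg t)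
      nlinarith [h4, h5, h6]
    have hεM' : 0 ≤ ε * M := mul_nonneg hε hM0
    have key : w + (2 * ε ^ 2 - 5 * ε ^ 3 * M) * g x ^ 2 ≤ w + w ^ 2 / 2 - w ^ 3 / 6 := by
      have : (2 * ε ^ 2 - 5 * ε ^ 3 * M) * g x ^ 2 = 2 * t ^ 2 - 5 * (ε * M) * t ^ 2 := by rw [ht2]; ring
      rw [this]
      nlinarith [hw2, hw3, sq_nonneg t, hεM']
    have e2 : 2 * ε * g x + ε ^ 2 * g x ^ 2 = w := by rw [hw, htdef]; ring
    rw [e2]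
    exact key.trans h1
  have hHm : Measurable fun x => (1 + ε * g x) ^ 2 := (measurable_const.add (hgm.const_mul ε)).pow_const 2
  have hHb : ∀ x, |(1 + ε * g x) ^ 2| ≤ (3 / 2) ^ 2 := fun x => by
    rw [abs_pow]
    refine pow_le_pow_left₀ (abs_nonneg _) ?_ 2
    have := abs_le.1 (ht x)
    rw [abs_le]; constructor <;> linarith
  have iH : Integrable (fun x => (1 + ε * g x) ^ 2) μ := hbint hHm _ hHb
  obtain ⟨C, hC⟩ := (isCompact_Icc (a := (0 : ℝ)) (b := (3 / 2) ^ 2)).exists_bound_of_continuousOn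
    Real.continuous_mul_log.continuousOn
  have iHlog : Integrable (fun x => (1 + ε * g x) ^ 2 * Real.log ((1 + ε * g x) ^ 2)) μ :=
    Integrable.of_bound (hHm.mul (Real.measurable_log.comp hHm)).aestronglyMeasurable C
      (ae_of_all _ fun x => hC _ ⟨(hpos x).le, (le_abs_self _).trans (hHb x)⟩)
  have hint_lower : ε ^ 2 * V + (2 * ε ^ 2 - 5 * ε ^ 3 * M) * V ≤
      ∫ x, (1 + ε * g x) ^ 2 * Real.log ((1 + ε * g x) ^ 2) ∂μ := by
    have ia : Integrable (fun x => 2 * ε * g x) μ := ig.const_mul _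
    have ib : Integrable (fun x => ε ^ 2 * g x ^ 2) μ := ig2.const_mul _
    have ic : Integrable (fun x => (2 * ε ^ 2 - 5 * ε ^ 3 * M) * g x ^ 2) μ := ig2.const_mul _
    have iab : Integrable (fun x => 2 * ε * g x + ε ^ 2 * g x ^ 2) μ := ia.add ib
    have iL : Integrable (fun x => (2 * ε * g x + ε ^ 2 * g x ^ 2) + (2 * ε ^ 2 - 5 * ε ^ 3 * M) * g x ^ 2) μ := iab.add ic
    have h1 := integral_mono iL iHlog hpt
    have e : ∫ x, (2 * ε * g x + ε ^ 2 * g x ^ 2) + (2 * ε ^ 2 - 5 * ε ^ 3 * M) * g x ^ 2 ∂μ =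
        ε ^ 2 * V + (2 * ε ^ 2 - 5 * ε ^ 3 * M) * V := by
      rw [integral_add iab ic, integral_add ia ib, integral_const_mul, integral_const_mul, integral_const_mul, hg0,
        mul_zero, zero_add]
    rw [e] at h1
    exact h1
  have hmass : ∫ x, (1 + ε * g x) ^ 2 ∂μ = 1 + ε ^ 2 * V := by
    have ee : ∀ x, (1 + ε * g x) ^ 2 = 1 + (2 * ε) * g x + ε ^ 2 * g x ^ 2 := fun x => by ring
    simp_rw [ee]
    have ia : Integrable (fun x => (2 * ε) * g x) μ := ig.const_mul _
    have ib : Integrable (fun x => ε ^ 2 * g x ^ 2) μ := ig2.const_mul _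
    have i1 : Integrable (fun x => 1 + (2 * ε) * g x) μ := (integrable_const _).add ia
    rw [integral_add i1 ib, integral_add (integrable_const _) ia, integral_const, probReal_univ, one_smul, integral_const_mul,
      integral_const_mul, hg0, mul_zero, add_zero]
  have hmlog : (∫ x, (1 + ε * g x) ^ 2 ∂μ) * Real.log (∫ x, (1 + ε * g x) ^ 2 ∂μ) ≤ ε ^ 2 * V + (ε ^ 2 * V) ^ 2 := by
    rw [hmass]; exact one_add_mul_log_le (by positivity)
  have hε4 : (ε ^ 2 * V) ^ 2 ≤ ε ^ 3 * V ^ 2 := by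
    have : ε ^ 4 ≤ ε ^ 3 := pow_le_pow_of_le_one hε hε1 (by norm_num)
    nlinarith [sq_nonneg V]
  nlinarith [hint_lower, hmlog, hε4]

/-- Bookkeeping for `semigroupPoincare_of_semigroupLogSobolev`: the final real-arithmetic step. [folklore] -/
theorem poincare_of_logSobolev_arith {ρ η V ε C X : ℝ} (hη : 0 ≤ η) (hV : 0 ≤ V) (hε : 0 ≤ ε)
    (hC : 0 ≤ C) (hεC : ρ * ε * C ≤ η * V / 4) (h2 : (ρ - η / 4) * (2 * V - ε * C) ≤ X) : (2 * ρ - η) * V ≤ X := by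
  have a1 : (ρ - η / 4) * (ε * C) ≤ ρ * (ε * C) := mul_le_mul_of_nonneg_right (by linarith) (mul_nonneg hε hC)
  have e4 : (ρ - η / 4) * (2 * V - ε * C) = 2 * (ρ * V) - (η * V) / 2 - (ρ - η / 4) * (ε * C) := by ring
  have e5 : (2 * ρ - η) * V = 2 * (ρ * V) - η * V := by ring
  have e6 : ρ * (ε * C) = ρ * ε * C := by ring
  rw [e5]; rw [e4] at h2
  nlinarith [a1, hεC, mul_nonneg hη hV, e6]

/-! ## §3. Log-Sobolev(ρ) ⇒ Poincaré(2ρ) -/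

/-- ★★ **Semigroup-form log-Sobolev(ρ) ⇒ semigroup-form Poincaré(2ρ)** on `C(X)`: if every continuous `H` has
`(ρ − η) Ent_μ(H²) ≤ 𝓔_h(H)` for some `h > 0` (every `η > 0`), then every continuous `G` has `(2ρ − η) Var_μ(G) ≤ 𝓔_h(G)` for some
`h > 0` (every `η > 0`).  Apply the hypothesis to `H = 1 + εG₀` (`G₀ = G − μG`): `𝓔_h(H) = ε²𝓔_h(G)` exactly and
`Ent_μ(H²) ≥ 2ε²Var(G) − O(ε³)`. [cite: BakryGentilLedoux2014, Prop. 5.1.3] -/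
theorem semigroupPoincare_of_semigroupLogSobolev (L : ℕ) [NeZero L] (β' : ℝ)
    (κ : ℝ≥0 → Kernel (GaugeConfig 3 L (Matrix.specialUnitaryGroup (Fin 2) ℂ))
      (GaugeConfig 3 L (Matrix.specialUnitaryGroup (Fin 2) ℂ))) [∀ t, IsMarkovKernel (κ t)]
    (hreal : ∀ (t : ℝ≥0) (x : GaugeConfig 3 L (Matrix.specialUnitaryGroup (Fin 2) ℂ))
        (Ω : Type) [MeasurableSpace Ω] (P : Measure Ω) [IsProbabilityMeasure P]
        (W : ℝ≥0 → Ω → (Edge 3 L × NoiseIdx 2 → ℝ)) (hW : IsFlatBrownian W P)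
        (U : ℝ≥0 → Ω → GaugeConfig 3 L (Matrix.specialUnitaryGroup (Fin 2) ℂ)),
        (∀ ω, U 0 ω = x) →
        (latticeLangevinDynamics (fundamentalLatticeRep 2) β').IsSolution (fundamentalRep (Fin 2))
          hW.natFiltration P W U →
        κ t x = P.map (U t))
    {ρ : ℝ}
    (hSLS : ∀ H : GaugeConfig 3 L (Matrix.specialUnitaryGroup (Fin 2) ℂ) → ℝ, Continuous H → ∀ η : ℝ, 0 < η →
      ∃ h : ℝ≥0, 0 < h ∧
        (ρ - η) * ((∫ x, H x ^ 2 * Real.log (H x ^ 2) ∂(wilsonMeasure (d := 3) (L := L) (fundamentalRep (Fin 2)) β')) -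
            (∫ x, H x ^ 2 ∂(wilsonMeasure (d := 3) (L := L) (fundamentalRep (Fin 2)) β')) * Real.log (∫ x, H x ^ 2 ∂(wilsonMeasure (d := 3) (L := L) (fundamentalRep (Fin 2)) β'))) ≤
          (h : ℝ)⁻¹ * ((∫ x, H x * H x ∂(wilsonMeasure (d := 3) (L := L) (fundamentalRep (Fin 2)) β')) -
            ∫ x, H x * (∫ y, H y ∂(κ h x)) ∂(wilsonMeasure (d := 3) (L := L) (fundamentalRep (Fin 2)) β')))
    {G : GaugeConfig 3 L (Matrix.specialUnitaryGroup (Fin 2) ℂ) → ℝ} (hG : Continuous G) {η : ℝ} (hη : 0 < η) :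
    ∃ h : ℝ≥0, 0 < h ∧
      (2 * ρ - η) * ∫ x, (G x - ∫ z, G z ∂(wilsonMeasure (d := 3) (L := L) (fundamentalRep (Fin 2)) β')) ^ 2 ∂(wilsonMeasure (d := 3) (L := L) (fundamentalRep (Fin 2)) β') ≤
        (h : ℝ)⁻¹ * ((∫ x, G x * G x ∂(wilsonMeasure (d := 3) (L := L) (fundamentalRep (Fin 2)) β')) -
          ∫ x, G x * (∫ y, G y ∂(κ h x)) ∂(wilsonMeasure (d := 3) (L := L) (fundamentalRep (Fin 2)) β')) := by
  classical
  haveI := secondCountableTopology_su2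
  haveI := borelSpace_config L
  set μ : Measure (GaugeConfig 3 L (Matrix.specialUnitaryGroup (Fin 2) ℂ)) := (wilsonMeasure (d := 3) (L := L) (fundamentalRep (Fin 2)) β') with hμ
  haveI : IsProbabilityMeasure μ :=
    isProbabilityMeasure_wilsonMeasure (d := 3) (L := L) (fundamentalRep (Fin 2)) (continuous_fundamentalRep (Fin 2)) β'
  set m : ℝ := ∫ z, G z ∂μ with hm
  set V : ℝ := ∫ x, (G x - m) ^ 2 ∂μ with hV
  have hV0 : 0 ≤ V := integral_nonneg fun x => sq_nonneg _
  by_cases htriv : (2 * ρ - η) * V ≤ 0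
  · exact ⟨1, one_pos, htriv.trans (dirichletScale_nonneg L β' κ hreal 1 hG)⟩
  have hpos : 0 < (2 * ρ - η) * V := lt_of_not_ge htriv
  have hVpos : 0 < V := by
    rcases hV0.lt_or_eq with h | h
    · exact h
    · exfalso; rw [← h, mul_zero] at hpos; exact lt_irrefl _ hpos
  have hρη : 0 < 2 * ρ - η := by
    by_contra hle; push Not at hle; exact absurd hpos (not_lt.2 (mul_nonpos_of_nonpos_of_nonneg hle hV0))
  have hρ : 0 < ρ := by linarith
  have hρη4 : 0 ≤ ρ - η / 4 := by linarith
  set G₀ : GaugeConfig 3 L (Matrix.specialUnitaryGroup (Fin 2) ℂ) → ℝ := fun x => G x - m with hG₀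
  have hG₀c : Continuous G₀ := hG.sub continuous_const
  obtain ⟨M₀, hM₀0, hM₀⟩ := exists_abs_le_of_continuous hG₀c
  set M : ℝ := max M₀ 1 with hMdef
  have hM1 : 1 ≤ M := le_max_right _ _
  have hGM : ∀ x, |G₀ x| ≤ M := fun x => (hM₀ x).trans (le_max_left _ _)
  have hG₀int : ∫ x, G₀ x ∂μ = 0 := by
    simp only [hG₀]
    rw [integral_sub (integrable_of_continuous_of_compactSpace hG _) (integrable_const m), integral_const, probReal_univ,
      one_smul, hm, sub_self]
  have hVG₀ : ∫ x, G₀ x ^ 2 ∂μ = V := rfl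
  set C₁ : ℝ := 5 * M * V + V ^ 2 with hC₁
  have hC₁0 : 0 ≤ C₁ := by positivity
  set ε : ℝ := min (1 / (2 * M)) (η * V / (4 * (ρ * C₁ + 1))) with hεdef
  have hε0 : 0 < ε := lt_min (by positivity) (by positivity)
  have hεM : ε * M ≤ 1 / 2 := by
    have h1 : ε ≤ 1 / (2 * M) := min_le_left _ _
    rw [le_div_iff₀ (by positivity)] at h1; linarith
  have hε1 : ε ≤ 1 := by nlinarith
  have hεC : ρ * ε * C₁ ≤ η * V / 4 := by
    have h1 : ε ≤ η * V / (4 * (ρ * C₁ + 1)) := min_le_right _ _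
    have h2 : ρ * C₁ * ε ≤ ρ * C₁ * (η * V / (4 * (ρ * C₁ + 1))) := mul_le_mul_of_nonneg_left h1 (by positivity)
    have h3 : ρ * C₁ * (η * V / (4 * (ρ * C₁ + 1))) ≤ η * V / 4 := by
      rw [mul_div_assoc', div_le_div_iff₀ (by positivity) (by positivity)]
      nlinarith [mul_nonneg (mul_nonneg hρ.le hC₁0) (mul_nonneg hη.le hV0)]
    nlinarith
  set H : GaugeConfig 3 L (Matrix.specialUnitaryGroup (Fin 2) ℂ) → ℝ := fun x => 1 + ε * G₀ x with hH
  have hHc : Continuous H := continuous_const.add (continuous_const.mul hG₀c)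
  obtain ⟨h, hh, hLS⟩ := hSLS H hHc (η / 4) (by positivity)
  refine ⟨h, hh, ?_⟩
  have hEH : (∫ x, H x * H x ∂μ) - ∫ x, H x * (∫ y, H y ∂(κ h x)) ∂μ =
      ε ^ 2 * ((∫ x, G₀ x * G₀ x ∂μ) - ∫ x, G₀ x * (∫ y, G₀ y ∂(κ h x)) ∂μ) :=
    dirichletScale_const_add_smul L β' κ hreal h hG₀c 1 ε
  have hEG : (∫ x, G x * G x ∂μ) - ∫ x, G x * (∫ y, G y ∂(κ h x)) ∂μ =
      (∫ x, G₀ x * G₀ x ∂μ) - ∫ x, G₀ x * (∫ y, G₀ y ∂(κ h x)) ∂μ := by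
    have e := dirichletScale_const_add_smul L β' κ hreal h hG₀c m 1
    have ee : ∀ x, m + 1 * G₀ x = G x := fun x => by simp only [hG₀]; ring
    simp_rw [ee, one_pow, one_mul] at e
    exact e
  have hEnt := entropy_sq_one_add_smul_ge μ hG₀c.measurable hGM hG₀int hε0.le hε1 hεM
  rw [hVG₀] at hEnt
  -- `hLS`: `(ρ − η/4) Ent(H²) ≤ h⁻¹ 𝓔-numerator(H)`; `H x ^ 2 = (1 + ε G₀ x)^2`
  have eH2 : ∀ x, H x ^ 2 = (1 + ε * G₀ x) ^ 2 := fun x => rfl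
  simp only [eH2] at hLS
  rw [hEH] at hLS
  rw [hEG]
  have hhR : (0 : ℝ) < h := by exact_mod_cast hh
  set E : ℝ := (∫ x, G₀ x * G₀ x ∂μ) - ∫ x, G₀ x * (∫ y, G₀ y ∂(κ h x)) ∂μ with hE
  have hE0 : 0 ≤ (h : ℝ)⁻¹ * E := dirichletScale_nonneg L β' κ hreal h hG₀c
  have h1 : (ρ - η / 4) * (2 * ε ^ 2 * V - ε ^ 3 * C₁) ≤ ε ^ 2 * ((h : ℝ)⁻¹ * E) := by
    have := mul_le_mul_of_nonneg_left hEnt hρη4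
    have e2 : (h : ℝ)⁻¹ * (ε ^ 2 * E) = ε ^ 2 * ((h : ℝ)⁻¹ * E) := by ring
    linarith [hLS, this, e2.le, e2.ge]
  have h2 : (ρ - η / 4) * (2 * V - ε * C₁) ≤ (h : ℝ)⁻¹ * E := by
    have hε2 : 0 < ε ^ 2 := by positivity
    have e3 : (ρ - η / 4) * (2 * ε ^ 2 * V - ε ^ 3 * C₁) = ε ^ 2 * ((ρ - η / 4) * (2 * V - ε * C₁)) := by ring
    rw [e3] at h1
    exact le_of_mul_le_mul_left h1 hε2
  exact poincare_of_logSobolev_arith hη.le hV0 hε0.le hC₁0 hεC h2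

/-- ★★ **Generator-form log-Sobolev(ρ) ⇒ generator-form Poincaré(2ρ) on `C³` cylinders**, at every `(L, β')`: if
`ρ Ent_μ(F²) ≤ −∫ F·𝓛f dμ_{β'}` for every `C³` `f` (`F = f∘coords`), then `2ρ Var_μ(F) ≤ −∫ (F − μF)·𝓛f dμ_{β'}` for every `C³`
`f`.  Chain: `semigroupLogSobolev_of_generatorLogSobolev` ⇒ `semigroupPoincare_of_semigroupLogSobolev` ⇒ `L²` decay at rate `2ρ`
(`integral_sq_transition_sub_le_exp_of_semigroupPoincare`) along THE kernels (`exists_transitionKernel`) ⇒ generator-form Poincaré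
(`generatorPoincare_of_integral_sq_transition_sub_le_exp`). [cite: BakryGentilLedoux2014, Prop. 5.1.3] -/
theorem generatorPoincare_of_generatorLogSobolev (L : ℕ) [NeZero L] (β' : ℝ) {ρ : ℝ}
    (hLSgen : ∀ (f : (Edge 3 L × Fin 2 × Fin 2 × Bool → ℝ) → ℝ), ContDiff ℝ 3 f →
        let coords : GaugeConfig 3 L (Matrix.specialUnitaryGroup (Fin 2) ℂ) → (Edge 3 L × Fin 2 × Fin 2 × Bool → ℝ) :=
          fun V q => (fun z : ℂ => if q.2.2.2 then z.im else z.re)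
            ((fundamentalRep (Fin 2) (V q.1) : Matrix (Fin 2) (Fin 2) ℂ) q.2.1 q.2.2.1)
        let gen : GaugeConfig 3 L (Matrix.specialUnitaryGroup (Fin 2) ℂ) → ℝ := fun V =>
          (∑ i : Edge 3 L × Fin 2 × Fin 2 × Bool, fderiv ℝ f (coords V) (Pi.single i 1) *
              (fun z : ℂ => if i.2.2.2 then z.im else z.re)
                ((latticeLangevinDynamics (fundamentalLatticeRep 2) β').drift
                  (matrixConfig (fundamentalRep (Fin 2)) V) i.1 i.2.1 i.2.2.1) +
          1 / 2 * ∑ i : Edge 3 L × Fin 2 × Fin 2 × Bool, ∑ j : Edge 3 L × Fin 2 × Fin 2 × Bool,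
            fderiv ℝ (fun z => fderiv ℝ f z (Pi.single i 1)) (coords V) (Pi.single j 1) *
              ∑ n : Edge 3 L × NoiseIdx 2,
                (if n.1 = i.1 then (fun z : ℂ => if i.2.2.2 then z.im else z.re)
                  ((latticeLangevinDynamics (fundamentalLatticeRep 2) β').noise
                    (matrixConfig (fundamentalRep (Fin 2)) V) i.1 n.2 i.2.1 i.2.2.1) else 0) *
                (if n.1 = j.1 then (fun z : ℂ => if j.2.2.2 then z.im else z.re)
                  ((latticeLangevinDynamics (fundamentalLatticeRep 2) β').noise
                    (matrixConfig (fundamentalRep (Fin 2)) V) j.1 n.2 j.2.1 j.2.2.1) else 0))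
        ρ * ((∫ V, f (coords V) ^ 2 * Real.log (f (coords V) ^ 2) ∂(wilsonMeasure (d := 3) (L := L) (fundamentalRep (Fin 2)) β')) -
            (∫ V, f (coords V) ^ 2 ∂(wilsonMeasure (d := 3) (L := L) (fundamentalRep (Fin 2)) β')) *
              Real.log (∫ V, f (coords V) ^ 2 ∂(wilsonMeasure (d := 3) (L := L) (fundamentalRep (Fin 2)) β'))) ≤
          -∫ V, f (coords V) * gen V ∂(wilsonMeasure (d := 3) (L := L) (fundamentalRep (Fin 2)) β'))
    (f : (Edge 3 L × Fin 2 × Fin 2 × Bool → ℝ) → ℝ) (hf : ContDiff ℝ 3 f) :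
        let coords : GaugeConfig 3 L (Matrix.specialUnitaryGroup (Fin 2) ℂ) → (Edge 3 L × Fin 2 × Fin 2 × Bool → ℝ) :=
          fun V q => (fun z : ℂ => if q.2.2.2 then z.im else z.re)
            ((fundamentalRep (Fin 2) (V q.1) : Matrix (Fin 2) (Fin 2) ℂ) q.2.1 q.2.2.1)
        let gen : GaugeConfig 3 L (Matrix.specialUnitaryGroup (Fin 2) ℂ) → ℝ := fun V =>
          (∑ i : Edge 3 L × Fin 2 × Fin 2 × Bool, fderiv ℝ f (coords V) (Pi.single i 1) *
              (fun z : ℂ => if i.2.2.2 then z.im else z.re)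
                ((latticeLangevinDynamics (fundamentalLatticeRep 2) β').drift
                  (matrixConfig (fundamentalRep (Fin 2)) V) i.1 i.2.1 i.2.2.1) +
          1 / 2 * ∑ i : Edge 3 L × Fin 2 × Fin 2 × Bool, ∑ j : Edge 3 L × Fin 2 × Fin 2 × Bool,
            fderiv ℝ (fun z => fderiv ℝ f z (Pi.single i 1)) (coords V) (Pi.single j 1) *
              ∑ n : Edge 3 L × NoiseIdx 2,
                (if n.1 = i.1 then (fun z : ℂ => if i.2.2.2 then z.im else z.re)
                  ((latticeLangevinDynamics (fundamentalLatticeRep 2) β').noise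
                    (matrixConfig (fundamentalRep (Fin 2)) V) i.1 n.2 i.2.1 i.2.2.1) else 0) *
                (if n.1 = j.1 then (fun z : ℂ => if j.2.2.2 then z.im else z.re)
                  ((latticeLangevinDynamics (fundamentalLatticeRep 2) β').noise
                    (matrixConfig (fundamentalRep (Fin 2)) V) j.1 n.2 j.2.1 j.2.2.1) else 0))
    2 * ρ * ∫ V, (f (coords V) - ∫ V', f (coords V') ∂(wilsonMeasure (d := 3) (L := L) (fundamentalRep (Fin 2)) β')) ^ 2
        ∂(wilsonMeasure (d := 3) (L := L) (fundamentalRep (Fin 2)) β') ≤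
      -∫ V, (f (coords V) - ∫ V', f (coords V') ∂(wilsonMeasure (d := 3) (L := L) (fundamentalRep (Fin 2)) β')) *
        gen V ∂(wilsonMeasure (d := 3) (L := L) (fundamentalRep (Fin 2)) β') := by
  obtain ⟨κ, hκM, -, hreal⟩ := exists_transitionKernel L β'
  haveI := hκM
  have hSP : ∀ G : GaugeConfig 3 L (Matrix.specialUnitaryGroup (Fin 2) ℂ) → ℝ, Continuous G → ∀ η : ℝ, 0 < η →
      ∃ h : ℝ≥0, 0 < h ∧
        (2 * ρ - η) * ∫ x, (G x - ∫ z, G z ∂(wilsonMeasure (d := 3) (L := L) (fundamentalRep (Fin 2)) β')) ^ 2 ∂(wilsonMeasure (d := 3) (L := L) (fundamentalRep (Fin 2)) β') ≤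
          (h : ℝ)⁻¹ * ((∫ x, G x * G x ∂(wilsonMeasure (d := 3) (L := L) (fundamentalRep (Fin 2)) β')) -
            ∫ x, G x * (∫ y, G y ∂(κ h x)) ∂(wilsonMeasure (d := 3) (L := L) (fundamentalRep (Fin 2)) β')) :=
    fun G hG η hη => semigroupPoincare_of_semigroupLogSobolev L β' κ hreal
      (fun H hH η' hη' => semigroupLogSobolev_of_generatorLogSobolev L β' κ hreal hLSgen hH hη') hG hη
  have hdecay := fun (G : GaugeConfig 3 L (Matrix.specialUnitaryGroup (Fin 2) ℂ) → ℝ) (hG : Continuous G) (t : ℝ≥0) =>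
    integral_sq_transition_sub_le_exp_of_semigroupPoincare L β' κ hreal hSP hG t
  exact generatorPoincare_of_integral_sq_transition_sub_le_exp L β' κ hreal hdecay f hf

end Summit.QuantumFields.YangMills.Theorems.ColdStartUniversality

end
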